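import Summits.Ventures.LatticeQCDFlow.Scaling.GraphSchemeSpectralGap

/-!
HONEST FRAMING: exact (Metropolis-corrected) sampling algorithms for lattice gauge theory; figures
of merit are autocorrelation/cost numbers at stated couplings and volumes; no continuum-physics
claim.

# GraphSchemeGapComparison — THE GAP OF THE HOMOGENEOUS EXCHANGE SCHEME IS MONOTONE IN THE SWAP AND REFRESH RATES AND DILUTES BY AT MOST `m/m'` UNDER ADDED PAIRS:
# `t ≤ t'`, `(1−t)w_0 ≤ (1−t')w'_0` ⇒ **`γ(P) ≤ γ(P')`**; `e ⊆ e'` (same rates) ⇒ **`(m/m')·γ(P_e) ≤ γ(P_{e'})`** (lean-2 GEN-48, ours)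

Venture-side (OURS).  Cell `lqcd-flow` (pub-lqcd), unit `pub-lqcd-lean-2-g48`, 2026-09-01.  Chapter AI (the sizes of the Robin ground state), file 13 — parent AI10 `GraphSchemeSpectralGap` (`γ = ρ`)
with AI1's comparison theorems (`groundState_rho_mono_rates`, `groundState_rho_superlist_ge`).  Two Markov-level readings of the Dirichlet principle for the Robin rate: on a connected list
(§1) more swapping AND more refreshing can only raise the gap — for two homogeneous schemes on the same list with `t ≤ t'` and hot rates `(1−t)w_0 ≤ (1−t')w'_0` (one positive law, exact
hot sampler, idle cold kernels, `|S| ≥ 2`) `γ(P) ≤ γ(P')`; (§2) listing MORE pairs at the same total swap probability `t` (each pair then proposed with probability `t/m'` instead of `t/m`)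
costs at most the dilution factor: `γ(P_{e'}) ≥ (m/m')·γ(P_e)` whenever `e` is a sub-list of `e'` (`e = e'∘ι`, `ι` injective) and `e` is connected.  No definitions.

* §1 `graphScheme_spectralGap_mono_rates`; §2 `graphScheme_spectralGap_superlist_ge`.

Reading (no numerics implied): no re-allocation of a fixed swap budget to fewer pairs is claimed to help or hurt in general (the sub-list may disconnect); what is typed is one-directional —
richer topologies are never slower than their dilution factor, faster rates never slower.  Literature grade (cell rule): OWN; nothing cited; no new bib keys.
-/

noncomputable section

open Finset Function Matrix
open Literature.Probability.MarkovChains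

namespace Summit.Ventures.LatticeQCDFlow.Scaling

variable {S : Type*} [Fintype S] [DecidableEq S] {K m : ℕ} (e : Fin m → Fin (K + 1) × Fin (K + 1)) {ν : S → ℝ} {M : Fin (K + 1) → S → S → ℝ} {w w' : Fin (K + 1) → ℝ} {t t' : ℝ}
  {P P' : (Fin (K + 1) → S) → (Fin (K + 1) → S) → ℝ}

/-! ## §1 Monotone in the rates -/

/-- **THE GAP IS MONOTONE IN THE SWAP AND REFRESH RATES:** two homogeneous schemes on the same connected list (`m ≥ 1`, distinct endpoints, one positive law `ν`, exact hot sampler, idle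
cold kernels, `|S| ≥ 2`) with `0 < t ≤ t' < 1` and `(1−t)w_0 ≤ (1−t')w'_0` (`w, w'` probability vectors, `w_0, w'_0 > 0`) satisfy **`γ(P) ≤ γ(P')`**. [ours] -/
theorem graphScheme_spectralGap_mono_rates [Nontrivial S] (hm : 1 ≤ m) (he : ∀ r, (e r).1 ≠ (e r).2)
    (hconn : ∀ A : Finset (Fin (K + 1)), A.Nonempty → A ≠ univ → ∃ r : Fin m, ((e r).1 ∈ A ∧ (e r).2 ∉ A) ∨ ((e r).2 ∈ A ∧ (e r).1 ∉ A))
    (hν : ∀ v, 0 < ν v) (hν1 : ∑ v, ν v = 1) (hM0 : ∀ u v, M 0 u v = ν v) (hidle : ∀ i : Fin K, ∀ u v, M i.succ u v = if v = u then 1 else 0)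
    (hw0 : ∀ k, 0 ≤ w k) (hw00 : 0 < w 0) (hw1 : ∑ k, w k = 1) (ht0 : 0 < t) (ht1 : t < 1)
    (hw0' : ∀ k, 0 ≤ w' k) (hw00' : 0 < w' 0) (hw1' : ∑ k, w' k = 1) (ht0' : 0 < t') (ht1' : t' < 1)
    (htt : t ≤ t') (hhh : (1 - t) * w 0 ≤ (1 - t') * w' 0)
    (hP : ∀ x y, P x y = t * ptGraphSwap (fun _ : Fin (K + 1) => ν) e (fun _ => Equiv.refl S) x y + (1 - t) * prodKernel w M x y)
    (hP' : ∀ x y, P' x y = t' * ptGraphSwap (fun _ : Fin (K + 1) => ν) e (fun _ => Equiv.refl S) x y + (1 - t') * prodKernel w' M x y) :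
    spectralGap (tensorFun (fun _ : Fin (K + 1) => ν)) P ≤ spectralGap (tensorFun (fun _ : Fin (K + 1) => ν)) P' := by
  obtain ⟨ρ, c, _, _, hcpos, _, hvertex, hgap⟩ := graphScheme_spectralGap_exists e hm he hconn hν hν1 hM0 hidle hw0 hw00 hw1 ht0 ht1 hP
  obtain ⟨ρ', c', _, _, hcpos', _, hvertex', hgap'⟩ := graphScheme_spectralGap_exists e hm he hconn hν hν1 hM0 hidle hw0' hw00' hw1' ht0' ht1' hP'
  rw [hgap, hgap']
  exact groundState_rho_mono_rates e hcpos ht0.le htt hhh hvertex hcpos' hvertex'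

/-! ## §2 Adding pairs -/

variable {m' : ℕ} (e' : Fin m' → Fin (K + 1) × Fin (K + 1))

/-- **ADDING PAIRS DILUTES THE GAP BY AT MOST `m/m'`:** `e = e'∘ι` with `ι : Fin m → Fin m'` injective (every pair of `e` is listed in `e'`), `e` connected (hence `e'`), both schemes with
the same `t`, `w`, law, sampler and idle kernels (`|S| ≥ 2`): **`(m/m')·γ(P_e) ≤ γ(P_{e'})`**. [ours] -/
theorem graphScheme_spectralGap_superlist_ge [Nontrivial S] (hm : 1 ≤ m) (he : ∀ r, (e r).1 ≠ (e r).2) (he' : ∀ r, (e' r).1 ≠ (e' r).2)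
    (hconn : ∀ A : Finset (Fin (K + 1)), A.Nonempty → A ≠ univ → ∃ r : Fin m, ((e r).1 ∈ A ∧ (e r).2 ∉ A) ∨ ((e r).2 ∈ A ∧ (e r).1 ∉ A))
    {ι : Fin m → Fin m'} (hι : Function.Injective ι) (heι : ∀ r, e r = e' (ι r))
    (hν : ∀ v, 0 < ν v) (hν1 : ∑ v, ν v = 1) (hM0 : ∀ u v, M 0 u v = ν v) (hidle : ∀ i : Fin K, ∀ u v, M i.succ u v = if v = u then 1 else 0)
    (hw0 : ∀ k, 0 ≤ w k) (hw00 : 0 < w 0) (hw1 : ∑ k, w k = 1) (ht0 : 0 < t) (ht1 : t < 1)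
    (hP : ∀ x y, P x y = t * ptGraphSwap (fun _ : Fin (K + 1) => ν) e (fun _ => Equiv.refl S) x y + (1 - t) * prodKernel w M x y)
    (hP' : ∀ x y, P' x y = t * ptGraphSwap (fun _ : Fin (K + 1) => ν) e' (fun _ => Equiv.refl S) x y + (1 - t) * prodKernel w M x y) :
    (m : ℝ) / m' * spectralGap (tensorFun (fun _ : Fin (K + 1) => ν)) P ≤ spectralGap (tensorFun (fun _ : Fin (K + 1) => ν)) P' := by
  have hm' : 1 ≤ m' := le_trans hm (by simpa using Fintype.card_le_of_injective ι hι)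
  -- `e'` is connected too: a crossing pair of `e` is a crossing pair of `e'`
  have hconn' : ∀ A : Finset (Fin (K + 1)), A.Nonempty → A ≠ univ → ∃ r : Fin m', ((e' r).1 ∈ A ∧ (e' r).2 ∉ A) ∨ ((e' r).2 ∈ A ∧ (e' r).1 ∉ A) := by
    intro A hA hAu
    obtain ⟨r, hr⟩ := hconn A hA hAu
    refine ⟨ι r, ?_⟩
    rw [← heι r]; exact hr
  obtain ⟨ρ, c, _, _, hcpos, _, hvertex, hgap⟩ := graphScheme_spectralGap_exists e hm he hconn hν hν1 hM0 hidle hw0 hw00 hw1 ht0 ht1 hP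
  obtain ⟨ρ', c', _, _, hcpos', _, hvertex', hgap'⟩ := graphScheme_spectralGap_exists e' hm' he' hconn' hν hν1 hM0 hidle hw0 hw00 hw1 ht0 ht1 hP'
  rw [hgap, hgap']
  have hh : 0 ≤ (1 - t) * w 0 := (mul_pos (by linarith) hw00).le
  exact groundState_rho_superlist_ge e hm ht0.le hh e' hι heι hcpos hvertex hcpos' hvertex'

end Summit.Ventures.LatticeQCDFlow.Scaling

end
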